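import Mathlib
import HarnessLib
import HarnessLib.Audit
import Summits.PneNP.Statement
import Literature.Computability.Complexity.RangeAvoidance
import Summits.PneNP.PneNP.Theorems.Nc03AvoidResidualCoreCandFewHeadsRung
import Summits.PneNP.PneNP.Theorems.Nc03AvoidResidualCoreCandFewHeadsRungFP
import Summits.PneNP.PneNP.Theorems.Nc03AvoidResidualCoreCandMatchRung
import Summits.PneNP.PneNP.Theorems.Nc03AvoidResidualCoreCandMatchRungFP
import HarnessLib.Audit.Status.Attr

/-!
Route: Nc03AvoidResidualCore

# Route Nc03AvoidResidualCore — NC⁰₃ range avoidance at linear stretch reduces to its CAND core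

Rung F-N1b of the PneNP frontier ladder (lens N-α; ALT-CLOSER
`Summit.PneNP.PneNP.NC03AvoidLinearFP`, D-0061 — NOT summit-closing).
It suffices to show X = X1 ∧ X2: X1 = CAND-AVOID at linear stretch is in FP (pure instances of the
predicate c ⊕ (a∧b)); X2 = the
RESIDUAL-CORE REDUCTION X1 → NC⁰₃-AVOID[n, C·n] ∈ FP (truth-table bucketing + relaxation to pure
single-predicate instances + polynomial-time
algorithms for the NINE other NPN classes of non-degenerate 3-bit predicates: affine, AND₃, x∧(y∨z),
MAJ (monotone, Kuntewar–Sarma Thm 8),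
ALL-EQUAL (m ≥ n), x∧(y⊕z) (m ≥ n+1), G = {000,100,111} (m ≥ 2n), ONE-HOT (m ≥ 3n+1), MUX (m ≥
10n+1, exact-balance rigidity — ROUND-3 memo of
cell pnp-ideate seat p2, §2 and Addendum A).
Lean: `Literature.Computability.Complexity.LocalAvoidLinearFP 3 (fun _ _ I => I.IsPure
Literature.Computability.Complexity.candPred) ∧
(Literature.Computability.Complexity.LocalAvoidLinearFP 3 (fun _ _ I => I.IsPure
Literature.Computability.Complexity.candPred) →
Literature.Computability.Complexity.LocalAvoidLinearFP 3 (fun _ _ _ => True))`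

## Assembly
Pure logic: ResidualCoreReduction applied to CandAvoidLinearFP gives the rung leaf
`Summit.PneNP.PneNP.NC03AvoidLinearFP`
(glue.lean tonight: `theorem closes (h₁ : CandAvoidLinearFP) (h₂ : ResidualCoreReduction) :
Literature.Computability.Complexity.LocalAvoidLinearFP 3 (fun _ _ _ => True) := h₂ h₁` — the rung
leaf's DEFINIENS, so the route is born `draft` (conclusion ≠ `PneNP`); once the leaf
`Summits/PneNP/PneNP/Theorems/NC03AvoidLinearFP.lean` (staged, farm rc 0) is landed by a
prover/operator and registered as ALT-CLOSER (D-0061), `ledger route edit <id> --closes-file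
glue.lean` with conclusion `Summit.PneNP.PneNP.NC03AvoidLinearFP` (definitionally equal) certifies
it); both cruxes
are load-bearing (bridge shape T ∧ (T → S′) with T open and T → S′ a genuine theorem of nine class
algorithms).
The route closes the RUNG LEAF (ALT-CLOSER, D-0061), not `PneNP`: no implication to the summit is
claimed.

CLOSES_TARGET: closes rung F-N1b of PneNP: Summit.PneNP.PneNP.Theses.Nc03AvoidResidualCore.Nc03AvoidLinearFP (D-0061; not the summit Statement) — the deciding theorem of this route concludes that registered leaf instead of the Statement decl `PneNP` (class rung: servable and labelled, never counted as concluding the summit Statement).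

Rationale: WHY THIS LINE. Print solves NC⁰₃-AVOID deterministically only from stretch m ≥ c·n·log n
(GuruswamiLyuYuan2025 Thm 1.3, spectral/Kikuchi refutation
certificates, whose pessimistic estimators stall at n log n) and, predicate-restricted, for MONOTONE
outputs at m > n (KuntewarSarma2025
Thm 8, Turán-type hypergraph bounds); FP^NP lists exist at n^{1.4} (KortenPitassiImpagliazzo2025 Thm
3). The mechanism here is a
PREDICATE CALCULUS: pigeonhole over the ≤ 256 × 5 output types makes one type carry ≥ m/1280
outputs, relaxation (negated literal ↦ fresh
variable, coincident roles ↦ copies; Range only grows, n ↦ ≤ 3n) makes the instance pure, and each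
NPN class is then an explicit
combinatorial problem; nine of the ten classes fall to exact 𝔽₂-linear algebra / hypergraph-forest /
row-matroid series-class / exact-balance
rigidity arguments (five of them new: ALL-EQUAL, x∧(y⊕z), G, ONE-HOT — correcting the invalid Lemma
5.2 of ECCC TR25-034 — and MUX, whose
balanced colourings are rigid: Range ∩ Balanced ⊆ colspace_𝔽₂[selector | component incidence],
beaten by the cycle space), leaving exactly
CAND (membership NP-complete; induced-subgraph avoidance over matching classes ⟺ a designed-polarity
3-CNF refutation on the head bits; the
only class where the level-2 spectral certificate of ROUND-2 is needed). Imported areas: matroid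
theory (cocircuits = odd-cut edge sets),
Eulerian transition systems + cycle spaces, spectral signing (for CAND only). No prior route of
PneNP touches range avoidance (negatives index: nothing on AVOID).

RANKED CRUXES. #2 CandAvoidLinearFP (crux) — CAND-AVOID at linear stretch is in FP: some absolute C
and one polynomial-time string function output, for every pure CAND-instance (y_j = x_{c_j} ⊕
(x_{a_j} ∧ x_{b_j}), distinct roles) with n ≥ 1 and m ≥ C·n, a string outside its range (ROUND-3
§2.9: the hard core; equivalently induced-subgraph avoidance over matching classes). [difficulty:
open-problem] (why it might fail: membership is NP-complete and high-girth matching-class instances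
have no bounded unsat motif; the only certificate line (grouped spectral signing, GroupedDualConj)
may need Ω(n log n) outputs like every moment method in print.) [GuruswamiLyuYuan2025,
KuntewarSarma2025, GajulapalliEtAl2023, arXiv:1604.03544]
#3 ResidualCoreReduction (crux) — the residual-core reduction: if CAND-AVOID at linear stretch is in
FP then so is NC⁰₃-AVOID — bucketing by output type, relaxation to pure instances, and
polynomial-time avoidance for the other nine NPN classes (affine; AND₃, x∧(y∨z), MAJ via monotone m
> n; ALL-EQUAL m ≥ n; x∧(y⊕z) m ≥ n+1; G-class m ≥ 2n; ONE-HOT m ≥ 3n+1; MUX m ≥ 10n+1 by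
exact-balance rigidity), composed as one IsPolyTime function (ROUND-3 §2.1–2.8, Addendum A). [deps:
CandAvoidLinearFP] [difficulty: L] (why it might fail: the five new class theorems are informal and
days old (ONE-HOT series-class lemma; MUX sign-normalisation and T-join bookkeeping; G-class count);
composing IsPolyTime functions is proof_wanted in Mathlib (TM2ComputableInPolyTime.comp); relaxation
triples n, so every class threshold must be linear.) [KuntewarSarma2025, GuruswamiLyuWang2022,
GuruswamiLyuYuan2025]

TWO-LAYER PLAN. ResidualCoreReduction ⇐ Bucketing → ClassTheorems → ResidualCoreReduction, where
Bucketing = "if every pure NPN class P has P-AVOID[n, c_P·n] ∈ FP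
then NC⁰₃-AVOID[n, (Σ_P 3c_P + 1)·1280·n] ∈ FP" and ClassTheorems = the conjunction of the nine
solved classes (skeleton stubs: stub_affine,
stub_monotone (K–S Thm 8), stub_allEqual, stub_aox, stub_gclass, stub_oneHot, stub_mux — statements
typed in the cell file Sketch-R3.lean as
NaeBasisAvoid / AoxAvoid / GForestAvoid / OneHotCert ∧ OneHotAvoid, and `MuxAvoidLinearFP :=
LocalAvoidLinearFP 3 (IsPure muxPred)` (Addendum A)). CandAvoidLinearFP ⇐ CandMatchingReduction →
CandMatchAvoidFP → CandAvoidLinearFP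
(cherry forcing reduces to matching classes; Addendum B, Thm B.1). Below CandMatchAvoidFP the live
skeleton is the CERTIFICATE LINE
(Addendum C): CandMatchAvoidFP ⇐ GroupedCert → HubCase → CandMatchAvoidFP, where GroupedCert = "a
poly-time f outputs, for every β-balanced
paired head–data graph with 2m ≥ 2C·n edges, a grouped signing T with SDP(A(T)) + 4L₁(T) < 2m"
(random T does this w.h.p. at m ≥ 120n —
Addendum C Prop. C.1, which also gives NC⁰₃-AVOID[n, Cn] ∈ FZPP; the content is the LOG-FREE
derandomisation: interlacing G1+G2, or
Bilu–Linial + deterministic LLL on expanding clusters) and HubCase = the instances with a constant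
fraction of pairs at data vertices of
degree ≫ C. Nothing of this is filed now.

Update 2026-08-25T20:35Z (Addendum C §C.9, Kadison–Singer form): existence of a certifying grouped
signing for every instance with class sizes ≥ 110 and signless edge-leverages ≤ 0.009 is a THEOREM
(MSS II Thm 1.4 applied to v_j = e_c ± ĝ_j; certificate = LMI Ã(T) ≼ κF); general instances reduce
to that case log-free modulo Conj. C.4′ (equivariant Alev–Anari–Lau–Oveis Gharan resistance
clustering, arXiv:1711.06530). The residual crux of CandAvoidLinearFP is therefore: CONSTRUCTIVE
one-sided Kadison–Singer signing at constant scale for the support-4 graphic family (best algorithm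
in print 2^{Õ(∛m)}, arXiv:1704.03892); foreseen split stub_core ↦ stub_reduce (C.4′) + stub_ks
(crux) + stub_cert.

Update 2026-08-25T21:00Z (Addendum C §C.11, RIDGE PADDING): the live skeleton for CandAvoidLinearFP
is now CandAvoidLinearFP ⇐ stub_cert → stub_ks → CandAvoidLinearFP with
stub_cert (S/M) = "an LMI M(T) − F ≼ θ(F + λI) with (√3/2)θ(4m + λ(n+1)) < m certifies y(T) ∉ Range
for every pure CAND instance" and stub_ks (THE crux, XL) = "a poly-time f outputs such a T
for every pure CAND instance with m ≥ C₁(n+1)" = CONSTRUCTIVE KS₂ for the padded two-point family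
{e_c ± ĝ_j} ∪ ridge. Existence of T is a THEOREM (Addendum C Thm C.7: MSS II Thm 1.4 on the
ridge-padded family; ε = 1/90, λ = 180, C₁ = 180) with NO structural hypothesis (no matching
classes, no leverage/class-size condition, no pruning); the deterministic 2^{Õ(n^{1/3})} rung
follows
by Anari–Oveis Gharan–Saberi–Srivastava rounding (arXiv:1704.03892 Thm 4.4/4.6). HubCase, Lemma C.4′
and the matching-class reduction are no longer on the path (kept as support for Prop C.1).

KILL CRITERIA. A proof that CAND-AVOID[n, Cn] ∈ FP implies an explicit rigid matrix / a super-linear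
circuit lower bound (GGNS-type reduction reaching stretch Cn)
re-labels the rung barrier-bound and closes the route as `exhausted` (instrument lost); a refutation
of ResidualCoreReduction's class theorems
(a pure ONE-HOT / G / ALL-EQUAL / AOX instance above threshold where the certified string lies in
the range) forces a pivot to the repaired
threshold, not a close; NC⁰₃-AVOID[n, Cn] ∈ FP appearing in print moots the route (cite and close
`superseded`). Line-level kills (Addendum C): a paired
bipartite graph with ≤ 16 pairs whose grouped-signing characteristic polynomials are NOT an
interlacing family kills G1 (exhaustive exact
search j244819: 0 failures in > 1600 graphs so far); a β-balanced family with min_T λ_max(A(T)) >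
(average degree)/2 at m = Cn for growing C
kills the uniform-dual variant; NP-hardness of coarse (constant-factor) grouped graphic discrepancy
would kill the constructive step K2♭.

- (added 20:35Z) NP-hardness of COARSE one-sided KS₂ signing for support-4 graphic families with a
private block coordinate would kill the spectral line (P-β/P-γ′); only non-spectral certificates
(P-α) would remain.

NOT DECOMPOSED YET. The constants (C = Σ thresholds ≈ 1280·(9n-coefficients); ONE-HOT 3n+1 vs
empirical n+1; G 2n vs n), the IsPolyTime plumbing (composition,
Gaussian elimination, rank oracle as TM2 machines), and the CAND sub-structure (matching-class
reduction, grouped signing certificate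
GroupedDualConj, representative-edge designs) are layer-2 children, filed only after a crux closes
or a skeleton registers them.

CHEAPEST FALSIFIER. Brute force (kit, n ≤ 16, done: jobs j243724 / j243904 of cell pnp-ideate):
every certified string of the four new class algorithms verified
outside the range (309/309 ONE-HOT, 180/180 ALL-EQUAL, 150/150 AOX, 178/180 G with the 2 misses
below threshold) — 0 wrong. Next cheapest:
the MUX algorithm of Addendum A was run verbatim on 3 000+ pure instances (kit j244391/j244442:
every stretch m ≥ n+1 ok, 0 balanced strings in
the range, 2-SAT = brute force); next: a kit search (n ≤ 14) for the cheapest falsifier of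
GroupedDualConj (CAND certificate line) and a literature
lookup for "NC0 3 avoid linear stretch" newer than GuruswamiLyuYuan2025 / Li–Zhong ITCS 2026.

NUMBERS. Stretch thresholds for deterministic NC⁰₃-AVOID: c·n·log n (GuruswamiLyuYuan2025 Thm 1.3, t
= 3); n (monotone, KuntewarSarma2025 Thm 8; NC⁰₂,
GuruswamiLyuWang2022); n^{1.4} with an NP oracle (KortenPitassiImpagliazzo2025 Thm 3); hardness from
n + O(n^{2/3}) (GajulapalliEtAl2023 §1).
Class thresholds proved in ROUND-3 (+ Addendum A): ALL-EQUAL n, AOX n+1, AND-types n+1, G 2n,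
ONE-HOT 3n+1, MUX 10n+1 (pure unsigned |S|+2(|A|+|B|)); Cryan–Miltersen: NC⁰₃ maps with m ≥ 4n+1
fail a
linear test (CryanMiltersen2001 Thm 3), so no pseudorandomness-based hardness lives at locality 3
and linear stretch.
Certificate probe (Addendum C; kit j244630/j244689/j244709): optimal grouped-signing constant Kmin ∈
[1.28, 1.51] (36 graphs, exhaustive);
interlacing node tests 572/572, expected charpoly real-rooted 88/88; at m = 8n and 16n a RANDOM
grouped signing certifies (uniform dual) in
8/8 random instances up to n = 600, at m = 4n balanced + local search certifies 6/6; Prop. C.1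
constant: m ≥ 120n (union bound, unoptimised).

KS-form constants (Addendum C §C.11, Thm C.7): ε = 1/90, θ₁ = 2√ε+ε ≈ 0.222, ridge λ = 180, stretch
C₁ = 180 ⇒ certificate value ≤ 0.962·m < m; numerics (kit j245095, n = 200, general pure
CAND incl. hub families): with ridge λ ∈ {10, 40, 160} a RANDOM signing already certifies at C = 16
(μ = 0.248/0.144/0.073 vs thresholds 0.249/0.177/0.082), local search from C = 16 at λ = 0.

DEFINITION REQUESTS. Vocabulary Literature/Computability/Complexity/RangeAvoidance.lean (LocalMap,
encode, readOut, LocalAvoidLinearFP, muxPred, candPred) = proposal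
p405128; rung leaf Summits/PneNP/PneNP/Theorems/NC03AvoidLinearFP.lean (`@[conjecture] def
NC03AvoidLinearFP`) — tree-ready copy in the cell folder,
to be landed by a prover/operator and registered as ALT-CLOSER (D-0061) before this route can be
certified.

Novelty: Searches (2026-08-25): lit search --hybrid "range avoidance problem NC0 local functions exactly-one
one-in-three predicate polynomial time" (textbooks only); lit vsearch (prose form; none relevant);
lit search --source all "range avoidance NC0 local functions" (local: Li–Zhong ITCS'26, KPI25; arXiv
0; openalex/s2 rate-limited); lit galaxy search "range avoidance problem|Range Avoidance Problem"
--star all (8 pdf hits: Ren–Santhanam–Wang, GGNS ECCC23/021, Chen–Li, Li–Zhong ECCC25/049, CGLOSS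
ECCC23/193, Atserias–Tzameret ECCC24/174, Lu–Ren FOCS24 — none predicate-classified); galaxy pdf
"NC0-Avoid|NC^0-Avoid|local functions avoid" 0; "Monotone-NC|SYMMETRIC-NC|One-in-Three-Avoid" 0;
first-hand reads of GuruswamiLyuYuan2025 pp.5–6, KuntewarSarma2025 (LIPIcs + ECCC TR25-034 §5 +
arXiv v2), KortenPitassiImpagliazzo2025 pp.6,11,51–57, GajulapalliEtAl2023 pp.4–9.
Nearest prior art found: KuntewarSarma2025 (Thm 8: MONOTONE-NC⁰₃-AVOID m > n; ECCC version's
symmetric claim via the invalid Lemma 5.2), GuruswamiLyuYuan2025 (all of NC⁰₃ at m ≥ c n log n),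
GuruswamiLyuWang2022 (NC⁰₂), KortenPitassiImpagliazzo2025 (FP^NP lists).
Delta: nobody in print classifies the NON-unate 3-bit predicates at linear stretch or reduces
NC⁰₃-AVOID to one named predicate; five classes (ALL-EQUAL, x∧(y⊕z), G, ONE-HOT via row-matroid
series classes, MUX via exact-balance rigidity + cycle space) are new, the ONE-HOT theorem corrects
the only printed claim covering it, and Li–Zhong (LIPIcs.ITCS.2026.79 p.3) sti  [refs: GuruswamiLyuYuan2025, KuntewarSarma2025, KortenPitassiImpagliazzo2025, GajulapalliEtAl2023, GuruswamiLyuWang2022]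

Barriers (technique_class: explicit-construction, predicate-classification): - technique_class: explicit-construction, predicate-classification
- Literature.Barriers.PneNP.NaturalProofs: not engaged — the route proves no circuit lower bound and
defines no largeness/constructivity property of Boolean functions; NC⁰₃-AVOID at stretch C·n has no
known lower-bound consequence (GGNS consequences start at n + O(n^{2/3})).
- Literature.Barriers.PneNP.Relativization: not engaged — a white-box algorithm on a syntactic
class, no oracle-independent simulation argument.
- Literature.Barriers.PneNP.Algebrization: not engaged — same reason; nothing arithmetises.
- Cryptographic AVOID-hardness (ChenLi2024 depth-3 TC⁰ under LWE; RenWangZhong2025 §7.3 demi-bits at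
locality ≥ 5; Ilango–Li–Williams general circuits): outside their class — CryanMiltersen2001 Thm 3:
every NC⁰₃ map with m ≥ 4n+1 fails an explicit linear test, so no PRG/demi-bit object exists at
locality 3 and linear stretch; the bet of the rung is exactly that t = 3 is on the easy side.
- Negatives index: empty for range avoidance at filing (ledger negatives --problem PneNP: no AVOID
statement); the route steers around nothing recorded.

History (route lifecycle, newest last):
- 2026-08-26T10:16:37Z · closes_target -> closes rung F-N1b of PneNP: Summit.PneNP.PneNP.Theses.Nc03AvoidResidualCore.Nc03AvoidLinearFP (D-0061; not the summit Statement) (operator:999:3983483)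

sub-problem: PneNP · status: open · opened planner-pnp-ideate-p2-g3-0 2026-08-25T20:56:49Z · rev 8 · ledger route-PneNP-Nc03AvoidResidualCore
GENERATED by the gate from the ledger (D-0016/17). Provers cite these decls: `theorem foo : Summit.PneNP.PneNP.Theses.Nc03AvoidResidualCore.<Decl> := …` in Summits/PneNP/PneNP/Theorems/<Name>.lean.
-/

namespace Summit.PneNP.PneNP.Theses.Nc03AvoidResidualCore

open scoped BigOperators Topology Manifold Classical MeasureTheory ProbabilityTheory Matrix InnerProductSpace ComplexConjugate ContinuousMap
open Filter Set Function TopologicalSpace MeasureTheory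

attribute [summit_statement] _root_.PneNP
-- H21.Audit: the closer leaf Summit.PneNP.PneNP.Theses.Nc03AvoidResidualCore.Nc03AvoidLinearFP is an item decl of this route file — tagged summit_statement below, after its declaration

open Literature.PNP

/-- item stmt-PneNP-19962 · crux · rank 2 · closed · proved by Summit.PneNP.PneNP.Theorems.SfmBlMachine.candMatchAvoidLinearFP (prover) · by planner
why it might fail: high-girth matching-class instances carry no bounded unsat motif (local certificates stop at headCount³ ≤ k·n, candMatch_rungFP); every engine in print (Kikuchi / moment refutation) needs m ≥ c·n·log n at arity 3; range membership is NP-hard.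
sources: GuruswamiLyuYuan2025, KuntewarSarma2025, GajulapalliEtAl2023, arXiv:1604.03544
[crux] CAND^match-AVOID at linear stretch is in FP: for some absolute C, ONE polynomial-time string
function outputs, for every PURE-CAND 3-local instance (every output c ⊕ (a ∧ b) on three distinct
positions) whose head classes are MATCHINGS (IsMatchingClass: two outputs with the same head share
no data variable) with n ≥ 1 inputs and m ≥ C·n outputs, a point outside its range. This is the
residual OPEN CORE of rung F-N1b (cell dossier pnp-ideate-p2/OPEN-CORE.md form (1)); its landed
first rungs are candMatch_rungFP (k) (sub-family headCount³ ≤ k·n, p479284) and candFewHeads_rungFP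
(k). [deps: none] [difficulty: open-problem] -/
@[route_item "route-PneNP-Nc03AvoidResidualCore", crux]
def CandMatchAvoidLinearFP : Prop :=
  Literature.Computability.Complexity.LocalAvoidLinearFP 3 (fun _ _ I => I.IsPure Literature.Computability.Complexity.candPred ∧ Summit.PneNP.PneNP.Theorems.Nc03AvoidResidualCoreCandMatchRung.IsMatchingClass I)

-- `CandMatchAvoidLinearFP` holds: proved by `Summit.PneNP.PneNP.Theorems.SfmBlMachine.candMatchAvoidLinearFP` (its module imports this route file, so no `_holds` link can be stated here).

/-- item stmt-PneNP-20226 · crux · rank 2 · closed · proved by Summit.PneNP.PneNP.Theorems.SfmBlMachine.candAvoidLinearFP (prover) · by planner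
why it might fail: membership is NP-complete and high-girth matching-class instances have no bounded unsat motif; the only certificate line (grouped spectral signing, GroupedDualConj) may need Ω(n log n) outputs like every moment method in print.
sources: GuruswamiLyuYuan2025, KuntewarSarma2025, GajulapalliEtAl2023, arXiv:1604.03544
[crux] CAND-AVOID at linear stretch is in FP: some absolute C and one polynomial-time string
function output, for every pure CAND-instance (y_j = x_{c_j} ⊕ (x_{a_j} ∧ x_{b_j}), distinct roles)
with n ≥ 1 and m ≥ C·n, a string outside its range (ROUND-3 §2.9: the hard core; equivalently
induced-subgraph avoidance over matching classes). [difficulty: open-problem] -/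
@[route_item "route-PneNP-Nc03AvoidResidualCore"]
def CandAvoidLinearFP : Prop :=
  Literature.Computability.Complexity.LocalAvoidLinearFP 3 (fun _ _ I => I.IsPure Literature.Computability.Complexity.candPred)

-- `CandAvoidLinearFP` holds: proved by `Summit.PneNP.PneNP.Theorems.SfmBlMachine.candAvoidLinearFP` (its module imports this route file, so no `_holds` link can be stated here).

/-- item stmt-PneNP-19963 · crux · rank 3 · closed · proved by Summit.PneNP.PneNP.Theorems.candStarReduction_proof (prover) · by planner
why it might fail: Lemma B.3 (the cherry graph is a forest) is a days-old BFS/orientation argument checked only on 1206 small instances; the FP typing needs a second CodeFP solver composition (branch on #tangled, two sub-solvers) on top of the 46-module 20227 assembly.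
sources: KuntewarSarma2025, GuruswamiLyuWang2022, pnp-ideate-p2/ROUND-3-ADDENDUM-B.md Thm B.1 (kit j244555)
[crux] the ★-reduction (cell memo pnp-ideate-p2/ROUND-3-ADDENDUM-B Thm B.1): CAND^match-AVOID-linear
∈ FP ⇒ CAND^pure-AVOID-linear ∈ FP at stretch constant +1 — parallel kill (F1), cherry forcing (F2:
y_j ⊕ y_j′ = x_u·(x_w ⊕ x_w′)), the forcing forest (Lemma B.2 coverage, Lemma B.3 acyclicity ⇒ the
𝔽₂ cherry system is consistent of rank |F′|), affine avoidance by Gaussian elimination when ≥ n+1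
outputs are tangled, else restriction to the untangled sub-instance, which is matching-class on the
same n inputs with ≥ m − n outputs; kit j244555 certified 1206/1206 instances. Birth skeleton
(tribunal-w g5, farm rc 0, sorries = 2 stubs): stub_cherryStar : TangledSurplusFP (L) +
stub_tangledSplit : CandMatchAvoidLinearFP → TangledSurplusFP → CandAvoidLinearFP (M) ⊢
CandStarReduction_of. [deps: CandMatchAvoidLinearFP] [difficulty: L] -/
@[route_item "route-PneNP-Nc03AvoidResidualCore", crux]
def CandStarReduction : Prop :=
  CandMatchAvoidLinearFP → CandAvoidLinearFP

-- `CandStarReduction` holds: proved by `Summit.PneNP.PneNP.Theorems.candStarReduction_proof` (its module imports this route file, so no `_holds` link can be stated here).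

/-- item stmt-PneNP-20227 · crux · rank 3 · closed · proved by Summit.PneNP.PneNP.Theorems.residualCoreReduction_proof (prover) · by planner
why it might fail: the five new class theorems are informal and days old (ONE-HOT series-class lemma; MUX sign-normalisation and T-join bookkeeping; G-class count); composing IsPolyTime functions is proof_wanted in Mathlib (TM2ComputableInPolyTime.comp); relaxation triples n, so every class threshold must be linear.
sources: KuntewarSarma2025, GuruswamiLyuWang2022, GuruswamiLyuYuan2025
[crux] the residual-core reduction: if CAND-AVOID at linear stretch is in FP then so is NC⁰₃-AVOID —
bucketing by output type, relaxation to pure instances, and polynomial-time avoidance for the other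
nine NPN classes (affine; AND₃, x∧(y∨z), MAJ via monotone m > n; ALL-EQUAL m ≥ n; x∧(y⊕z) m ≥ n+1;
G-class m ≥ 2n; ONE-HOT m ≥ 3n+1; MUX m ≥ 10n+1 by exact-balance rigidity), composed as one
IsPolyTime function (ROUND-3 §2.1–2.8, Addendum A). [deps: CandAvoidLinearFP] [difficulty: L] -/
@[route_item "route-PneNP-Nc03AvoidResidualCore", crux]
def ResidualCoreReduction : Prop :=
  CandAvoidLinearFP → Literature.Computability.Complexity.LocalAvoidLinearFP 3 (fun _ _ _ => True)

-- `ResidualCoreReduction` holds: proved by `Summit.PneNP.PneNP.Theorems.residualCoreReduction_proof` (its module imports this route file, so no `_holds` link can be stated here).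

/-- item stmt-PneNP-19007 · aside · rank 0 · closed · proved by Summit.PneNP.PneNP.Theorems.SfmBlMachine.nc03AvoidLinearFP (prover) · by planner
[target] rung F-N1b leaf (lens N-α): NC⁰₃-AVOID[n, C·n] ∈ FP — one absolute C and one
polynomial-time f that, given any 3-local map with m ≥ C·n outputs, prints a string outside its
range. Same term as the staged Theorems leaf Summit.PneNP.PneNP.NC03AvoidLinearFP and as the
conclusion of this route's closes/Assembly (defeq); filed as the route's TARGET so that a tree decl
(Summit.PneNP.PneNP.Theses.Nc03AvoidResidualCore.Nc03AvoidLinearFP) exists for ALT-CLOSER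
registration (D-0061) without waiting for the Theorems leaf. Why it might fail: the residual CAND
core (item CandAvoidLinearFP) is summit-adjacent-hard in print only at stretch n+O(n^{2/3})
[GajulapalliEtAl2023]; at linear stretch nothing below 2^{n^{1-o(1)}} is known [arXiv:2507.22265
p.6]. Sources: GuruswamiLyuWang2022, KuntewarSarma2025, GajulapalliEtAl2023, arXiv:2507.22265. -/
@[route_item "route-PneNP-Nc03AvoidResidualCore"]
def Nc03AvoidLinearFP : Prop :=
  Literature.Computability.Complexity.LocalAvoidLinearFP 3 (fun _ _ _ => True)

-- `Nc03AvoidLinearFP` holds: proved by `Summit.PneNP.PneNP.Theorems.SfmBlMachine.nc03AvoidLinearFP` (its module imports this route file, so no `_holds` link can be stated here).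

-- TODO item stmt-PneNP-20523 · support · rank 3 · closed · proved by Summit.PneNP.PneNP.Theorems.SfmBlMachine.candCutNormSigningFP (prover) · by planner — BLOCKED: missing decl(s) Summit.PneNP.PneNP.Theorems.CandCutNorm.CandCutNormSigningFP; restate via `ledger route edit` once they land:
--   def CandCutNormSigningFP : Prop := Summit.PneNP.PneNP.Theorems.CandCutNorm.CandCutNormSigningFP

/-- item stmt-PneNP-20228 · assembly · rank 1 · closed · proved by Summit.PneNP.PneNP.Theorems.SfmBlMachine.nc03AvoidResidualCore_assembly (prover) · by planner
sources: KuntewarSarma2025, GuruswamiLyuYuan2025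
[assembly] CandAvoidLinearFP → ResidualCoreReduction → NC⁰₃-AVOID[n, C·n] ∈ FP (the definiens of the
rung leaf NC03AvoidLinearFP). -/
@[route_item "route-PneNP-Nc03AvoidResidualCore"]
def Assembly : Prop :=
  CandAvoidLinearFP → ResidualCoreReduction → Literature.Computability.Complexity.LocalAvoidLinearFP 3 (fun _ _ _ => True)

-- `Assembly` holds: proved by `Summit.PneNP.PneNP.Theorems.SfmBlMachine.nc03AvoidResidualCore_assembly` (its module imports this route file, so no `_holds` link can be stated here).

attribute [summit_statement] _root_.Summit.PneNP.PneNP.Theses.Nc03AvoidResidualCore.Nc03AvoidLinearFP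

/-! D-0027 §2.1 — DECIDING THEOREM (planner-authored via `route open/edit --closes-file`; by planner-tribunal-w-Nc03AvoidResidualCore-g6-0 2026-08-27T03:29:36Z):
its hypotheses are this route's items and its conclusion the registered leaf `Summit.PneNP.PneNP.Theses.Nc03AvoidResidualCore.Nc03AvoidLinearFP` (rung F-N1b, D-0061) (glue_lint), and it elaborates with this file. -/

@[closes "route-PneNP-Nc03AvoidResidualCore"] theorem closes (h₁ : CandMatchAvoidLinearFP) (h₂ : CandStarReduction) (h₃ : ResidualCoreReduction) :
    Nc03AvoidLinearFP := h₃ (h₂ h₁)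

end Summit.PneNP.PneNP.Theses.Nc03AvoidResidualCore
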